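import Summits.RiemannHypothesis.RiemannHypothesis.Theorems.IntegerScrewCensusDualMatrix
import Summits.RiemannHypothesis.RiemannHypothesis.Theorems.IntegerScrewCensusFastNodes

/-!
# Route `IntegerScrew` — kernel checker for the census DUAL certificates (13): `⟨S, Z⟩ < 0` from the u-table digits

`2^164·⟨S_{n+1}, Z⟩ ≤ sPairUpper CL CH Z urows [] 0` for a symmetric square `Z` with nonnegative diagonal, a valid
scaled-digit u-table (`UTabOK`) and `CL ≤ 2^162 ζ(2,¼) ≤ CH` (`sPairUpper_ge`, `frob_screw_lt`).
RH-free; nothing here bears on the truth of RH.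
-/

set_option linter.dupNamespace false
set_option autoImplicit false

namespace Summit.RiemannHypothesis.RiemannHypothesis.Theorems.IntegerScrew.Manifest.Fast

open Finset

/-- **One row of the bracket**: `Σ_{b} z_b T_b ≤ sRowUpper …` when every `T_b` is bracketed by the digits. -/
theorem sRowUpper_ge {CL CH : ℕ} {ua : ℕ × ℕ} : ∀ (zs : List ℤ) (ubs uabs : List (ℕ × ℕ)) (T : ℕ → ℝ),
    zs.length ≤ ubs.length → zs.length ≤ uabs.length →
    (∀ b, b < zs.length →
      ((CL : ℝ) + ua.1 + (ubs.getD b (0, 0)).1) - (((uabs.getD b (0, 0)).2 : ℝ) + OZ) ≤ T b ∧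
        T b ≤ ((CH : ℝ) + ua.2 + (ubs.getD b (0, 0)).2) - (((uabs.getD b (0, 0)).1 : ℝ) + OZ)) →
    ∑ b ∈ range zs.length, (zs.getD b 0 : ℝ) * T b ≤ (sRowUpper CL CH ua zs ubs uabs : ℝ)
  | [], _, _, _, _, _, _ => by simp [sRowUpper]
  | _ :: _, [], _, _, h, _, _ => by simp at h
  | _ :: _, _ :: _, [], _, _, h, _ => by simp at h
  | z :: zs, ub :: ubs, uab :: uabs, T, h1, h2, hT => by
    rw [List.length_cons, Finset.sum_range_succ']
    simp only [List.getD_cons_succ, List.getD_cons_zero]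
    have ih := sRowUpper_ge zs ubs uabs (fun b => T (b + 1)) (by simpa using h1) (by simpa using h2)
      (fun b hb => by simpa using hT (b + 1) (by simpa using hb))
    obtain ⟨hlo, hhi⟩ := hT 0 (by simp)
    simp only [List.getD_cons_zero] at hlo hhi
    unfold sRowUpper
    split_ifs with hz
    · push_cast
      have hz' : (0 : ℝ) ≤ z := by exact_mod_cast hz
      nlinarith [mul_le_mul_of_nonneg_left hhi hz']
    · push_cast
      have hz' : (z : ℝ) ≤ 0 := by exact_mod_cast (not_le.1 hz).le
      nlinarith [mul_le_mul_of_nonpos_left hlo hz']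

/-- One unfolding step of `sPairUpper`. -/
theorem sPairUpper_cons (CL CH : ℕ) (zr : List ℤ) (zrs : List (List ℤ)) (urow : List (ℕ × ℕ)) (urows : List (List (ℕ × ℕ)))
    (u1s : List (ℕ × ℕ)) (a : ℕ) :
    sPairUpper CL CH (zr :: zrs) (urow :: urows) u1s a =
      zr.getD a 0 * (((2 * CH + 2 * (urow.getD 1 (0, 0)).2 : ℕ) : ℤ) - ((2 * OZ : ℕ) : ℤ)) +
        2 * sRowUpper CL CH (urow.getD 1 (0, 0)) (zr.take a) u1s (urow.drop 2) +
        sPairUpper CL CH zrs urows (u1s ++ [urow.getD 1 (0, 0)]) (a + 1) := rfl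

/-- **The bracket of `2^164⟨S, Z⟩`** along the recursion of `sPairUpper` (rows `a … n−1`). -/
theorem sPairUpper_ge {CL CH n : ℕ} (Z : List (List ℤ)) (U : List (List (ℕ × ℕ))) (T : ℕ → ℕ → ℝ)
    (hn : Z.length = n) (hU : U.length = n) (hsq : ∀ row ∈ Z, row.length = Z.length)
    (hUlen : ∀ a, a < n → a + 2 ≤ (U.getD a []).length) (hdiag : ∀ a, a < n → 0 ≤ (Z.getD a []).getD a 0)
    (hoff : ∀ a, a < n → ∀ b, b < a →
      ((CL : ℝ) + ((U.getD a []).getD 1 (0, 0)).1 + ((U.getD b []).getD 1 (0, 0)).1) -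
          ((((U.getD a []).getD (b + 2) (0, 0)).2 : ℝ) + OZ) ≤ T a b ∧
        T a b ≤ ((CH : ℝ) + ((U.getD a []).getD 1 (0, 0)).2 + ((U.getD b []).getD 1 (0, 0)).2) -
          ((((U.getD a []).getD (b + 2) (0, 0)).1 : ℝ) + OZ))
    (hdg : ∀ a, a < n → T a a ≤ (2 * (CH : ℝ) + 2 * ((U.getD a []).getD 1 (0, 0)).2) - 2 * OZ) :
    ∀ (k a : ℕ), a + k = n →
      ∑ i ∈ Ico a n, ((((Z.getD i []).getD i 0 : ℤ) : ℝ) * T i i + 2 * ∑ b ∈ range i, (((Z.getD i []).getD b 0 : ℤ) : ℝ) * T i b) ≤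
        (sPairUpper CL CH (Z.drop a) (U.drop a) ((List.range a).map fun b => (U.getD b []).getD 1 (0, 0)) a : ℝ) := by
  intro k
  induction k with
  | zero =>
    intro a h
    rw [Nat.add_zero] at h
    subst h
    rw [Finset.Ico_self, Finset.sum_empty, List.drop_of_length_le hn.le]
    simp [sPairUpper]
  | succ k ih =>
    intro a h
    have ha : a < n := by omega
    have haZ : a < Z.length := by rw [hn]; exact ha
    have haU : a < U.length := by rw [hU]; exact ha
    rw [← List.getElem_cons_drop haZ, ← List.getElem_cons_drop haU, sPairUpper_cons]
    have hZa : Z[a] = Z.getD a [] := (List.getD_eq_getElem _ _ haZ).symm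
    have hUa : U[a] = U.getD a [] := (List.getD_eq_getElem _ _ haU).symm
    rw [hZa, hUa, show ((List.range a).map fun b => (U.getD b []).getD 1 (0, 0)) ++ [(U.getD a []).getD 1 (0, 0)] =
      (List.range (a + 1)).map fun b => (U.getD b []).getD 1 (0, 0) by rw [List.range_succ, List.map_append]; rfl]
    have htail := ih (a + 1) (by omega)
    rw [Finset.sum_eq_sum_Ico_succ_bot ha]
    -- the row `a`
    obtain ⟨hlen, hget⟩ := take_row hsq haZ
    have hrow := sRowUpper_ge (CL := CL) (CH := CH) (ua := (U.getD a []).getD 1 (0, 0)) ((Z.getD a []).take a)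
      ((List.range a).map fun b => (U.getD b []).getD 1 (0, 0)) ((U.getD a []).drop 2) (fun b => T a b)
      (by rw [hlen]; simp) (by rw [hlen, List.length_drop]; have := hUlen a ha; omega) (fun b hb => by
        rw [hlen] at hb
        have e1 : ((List.range a).map fun b => (U.getD b []).getD 1 (0, 0)).getD b (0, 0) = (U.getD b []).getD 1 (0, 0) := by
          rw [List.getD_eq_getElem _ _ (by simpa using hb)]; simp
        rw [e1, getD_drop_two]
        exact hoff a ha b hb)
    rw [hlen] at hrow
    rw [Finset.sum_congr rfl fun b hb => by rw [hget b (Finset.mem_range.1 hb)]] at hrow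
    have hd := mul_le_mul_of_nonneg_left (hdg a ha) (show (0 : ℝ) ≤ (((Z.getD a []).getD a 0 : ℤ) : ℝ) by exact_mod_cast hdiag a ha)
    push_cast
    nlinarith [hrow, hd, htail]

/-- **`2^164·⟨S_{n+1}, Z⟩ ≤ sPairUpper CL CH Z urows [] 0`**, hence `⟨S, Z⟩ < 0` when the integer is negative. -/
theorem frob_screw_lt {n CL CH : ℕ} (Z : List (List ℤ)) (utab : List (List (ℕ × ℕ)))
    (hsq : ∀ row ∈ Z, row.length = Z.length) (hn : Z.length = n)
    (hsymm : ∀ a b, a < n → b < n → (Z.getD a []).getD b 0 = (Z.getD b []).getD a 0)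
    (hdiag : ∀ a, a < n → 0 ≤ (Z.getD a []).getD a 0) (hutab : UTabOK utab n) (hul : n + 2 ≤ utab.length)
    (hCL : (CL : ℝ) ≤ 2 ^ 162 * RungCert.lerchC) (hCH : 2 ^ 162 * RungCert.lerchC ≤ CH)
    (hneg : sPairUpper CL CH Z ((utab.drop 2).take n) [] 0 < 0) :
    frob (screwMatrix n) (Zmat n Z) < 0 := by
  set U := (utab.drop 2).take n with hUdef
  have hU : U.length = n := by rw [hUdef, List.length_take, List.length_drop]; omega
  have hUrow : ∀ a, a < n → U.getD a [] = utab.getD (a + 2) [] := fun a ha => getD_urows utab ha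
  -- `T = 2^164 S` on `ℕ × ℕ`
  set T : ℕ → ℕ → ℝ := fun a b => if b < a then 2 ^ 164 * (RungCert.lerchC / 4 + RungCert.uR (a + 2) 1 + RungCert.uR (b + 2) 1 -
      RungCert.uR (a + 2) (b + 2)) else 2 ^ 164 * (RungCert.lerchC / 2 + 2 * RungCert.uR (a + 2) 1) with hT
  have hToff : ∀ a b, b < a → T a b = 2 ^ 164 * (RungCert.lerchC / 4 + RungCert.uR (a + 2) 1 + RungCert.uR (b + 2) 1 -
      RungCert.uR (a + 2) (b + 2)) := fun a b h => by simp [hT, h]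
  have hTdiag : ∀ a, T a a = 2 ^ 164 * (RungCert.lerchC / 2 + 2 * RungCert.uR (a + 2) 1) := fun a => by simp [hT]
  -- the digit brackets
  have hu1 : ∀ a, a < n → (((U.getD a []).getD 1 (0, 0)).1 : ℝ) ≤ 2 ^ 164 * RungCert.uR (a + 2) 1 + OZ ∧
      2 ^ 164 * RungCert.uR (a + 2) 1 + OZ ≤ (((U.getD a []).getD 1 (0, 0)).2 : ℝ) := fun a ha => by
    rw [hUrow a ha]
    obtain ⟨-, h⟩ := hutab (a + 2) (by omega) (by omega)
    obtain ⟨h1, h2, -⟩ := h 1 le_rfl (by omega)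
    exact ⟨h1, h2⟩
  have huab : ∀ a, a < n → ∀ b, b < a → (((U.getD a []).getD (b + 2) (0, 0)).1 : ℝ) ≤ 2 ^ 164 * RungCert.uR (a + 2) (b + 2) + OZ ∧
      2 ^ 164 * RungCert.uR (a + 2) (b + 2) + OZ ≤ (((U.getD a []).getD (b + 2) (0, 0)).2 : ℝ) := fun a ha b hb => by
    rw [hUrow a ha]
    obtain ⟨-, h⟩ := hutab (a + 2) (by omega) (by omega)
    obtain ⟨h1, h2, -⟩ := h (b + 2) (by omega) (by omega)
    exact ⟨h1, h2⟩
  have hmain := sPairUpper_ge (CL := CL) (CH := CH) Z U T hn hU hsq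
    (fun a ha => by rw [hUrow a ha, (hutab (a + 2) (by omega) (by omega)).1]) hdiag
    (fun a ha b hb => by
      rw [hToff a b hb]
      obtain ⟨ha1, ha2⟩ := hu1 a ha
      obtain ⟨hb1, hb2⟩ := hu1 b (hb.trans ha)
      obtain ⟨hab1, hab2⟩ := huab a ha b hb
      constructor <;> nlinarith)
    (fun a ha => by rw [hTdiag a]; obtain ⟨-, ha2⟩ := hu1 a ha; nlinarith) n 0 (by simp)
  simp only [List.range_zero, List.map_nil, List.drop_zero, Nat.Ico_zero_eq_range] at hmain
  -- `frob S Z = Σ_i (Z_ii S_ii + 2 Σ_{b<i} Z_ib S_ib)`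
  have hsymmS : ∀ i j : Fin n, screwMatrix n j i = screwMatrix n i j := fun i j => by
    simpa using (screwMatrix_isHermitian n).apply i j
  set P : ℕ → ℕ → ℝ := fun a b => (if h : a < n ∧ b < n then screwMatrix n ⟨a, h.1⟩ ⟨b, h.2⟩ else 0) *
    (((Z.getD a []).getD b 0 : ℤ) : ℝ) with hP
  have hPdef : ∀ a b, P a b = (if h : a < n ∧ b < n then screwMatrix n ⟨a, h.1⟩ ⟨b, h.2⟩ else 0) *
    (((Z.getD a []).getD b 0 : ℤ) : ℝ) := fun a b => rfl
  have hfrob0 : frob (screwMatrix n) (Zmat n Z) = ∑ i ∈ range n, ∑ j ∈ range n, P i j := by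
    have hS : screwMatrix n = Matrix.of fun i j : Fin n =>
        (fun a b : ℕ => if h : a < n ∧ b < n then screwMatrix n ⟨a, h.1⟩ ⟨b, h.2⟩ else 0) i j := by
      ext i j; simp
    have hf := frob_of_nat n (fun a b : ℕ => if h : a < n ∧ b < n then screwMatrix n ⟨a, h.1⟩ ⟨b, h.2⟩ else 0)
      (fun a b : ℕ => (((Z.getD a []).getD b 0 : ℤ) : ℝ))
    rw [hS, Zmat_of, hf]
  have hPsymm : ∀ i j, i < n → j < n → P i j = P j i := fun i j hi hj => by
    rw [hPdef, hPdef, dif_pos ⟨hi, hj⟩, dif_pos ⟨hj, hi⟩, hsymmS ⟨j, hj⟩ ⟨i, hi⟩, hsymm i j hi hj]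
  have hPoff : ∀ i, i < n → ∀ j, j < i → 2 ^ 164 * P i j = (((Z.getD i []).getD j 0 : ℤ) : ℝ) * T i j := fun i hi j hj => by
    rw [hPdef, dif_pos ⟨hi, hj.trans hi⟩, screw_offdiag ⟨i, hi⟩ ⟨j, hj.trans hi⟩ hj, hToff i j hj]
    ring
  have hPdiag : ∀ i, i < n → 2 ^ 164 * P i i = (((Z.getD i []).getD i 0 : ℤ) : ℝ) * T i i := fun i hi => by
    rw [hPdef, dif_pos ⟨hi, hi⟩, screw_diag ⟨i, hi⟩, hTdiag i]
    ring
  have hfrob : 2 ^ 164 * frob (screwMatrix n) (Zmat n Z) =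
      ∑ i ∈ range n, ((((Z.getD i []).getD i 0 : ℤ) : ℝ) * T i i + 2 * ∑ b ∈ range i, (((Z.getD i []).getD b 0 : ℤ) : ℝ) * T i b) := by
    rw [hfrob0, sum_square_split, Finset.sum_add_distrib, Finset.sum_add_distrib, sum_upper_swap]
    have hsw : ∑ j ∈ range n, ∑ i ∈ range j, P i j = ∑ j ∈ range n, ∑ i ∈ range j, P j i :=
      Finset.sum_congr rfl fun j hj => Finset.sum_congr rfl fun i hi =>
        hPsymm i j ((Finset.mem_range.1 hi).trans (Finset.mem_range.1 hj)) (Finset.mem_range.1 hj)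
    rw [hsw, mul_add, mul_add, Finset.mul_sum, Finset.mul_sum, ← Finset.sum_add_distrib, ← Finset.sum_add_distrib]
    refine Finset.sum_congr rfl fun i hi => ?_
    rw [Finset.mem_range] at hi
    rw [hPdiag i hi, Finset.mul_sum, Finset.sum_congr rfl fun j hj => hPoff i hi j (Finset.mem_range.1 hj)]
    ring
  have hcast : ((sPairUpper CL CH Z U [] 0 : ℤ) : ℝ) < 0 := by exact_mod_cast hneg
  have h2 : 2 ^ 164 * frob (screwMatrix n) (Zmat n Z) < 0 := by rw [hfrob]; linarith
  nlinarith

end Summit.RiemannHypothesis.RiemannHypothesis.Theorems.IntegerScrew.Manifest.Fast
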